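import Literature.NumberTheory.Automorphic.AsaiSign
import Literature.NumberTheory.Automorphic.AutomorphicRepsGLSatakeFlathProofs
import Literature.NumberTheory.Automorphic.BaseChangeInductionAlong
import HarnessLib

/-!
# `HostInducedRep` (stmt-Langlands-10902) — negative knowledge I: the typed Asai sign

Support lemmas of the standing disprover (`Cruxes/HostInducedRep/Disproof.lean`, gen-5 §13) for the
sign stubs of the two filed lines of the crux (`Lines/one-transparent-pane.lean`: `stub_signPin`,
`stub_paneLaw`, `stub_package`; `Lines/grs-explicit-descent.lean`: `stub_signedTwist`), all of which
consume or produce the accepted predicates `AutomorphicRepData.HasAsaiPole` / `HasAsaiSign` of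
`Literature.NumberTheory.Automorphic.AsaiSign`.  None asserts a route statement; they record what
the TYPED sign is and is not.

* `hasAsaiPole_of_forall_not_isAsaiDatum`, `hasAsaiSign_of_forall_not_isAsaiDatum` — the typed pole
  is a `∀` over Asai data, so a representation datum WITHOUT Asai data has the pole for BOTH signs
  (vacuity hazard of every statement concluding something from `HasAsaiSign c κ`).
* `inertiaDeg_eq_two_of_smul_eq_of_isUnramifiedIn`, `exists_isAsaiDatum` — the cure, outright: over a
  quadratic `E/F` with non-trivial `c` EVERY automorphic representation datum of `GL_N(𝔸_E)` admits
  an Asai datum (Flath's cofiniteness `hasSatakeParamAt_cofinite_holds` + finiteness of the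
  different `finite_setOf_not_isUnramifiedIn` + "a `c`-fixed place over an unramified `v` is inert,
  `f = 2`").  This is the input of Mok-uniqueness (`existsUnique_hasAsaiSign`) that `stub_paneLaw`
  needs and its docstring only asserts.
* `not_hasAsaiPole_of_frequently_not_multipliable` — the typed pole is a limit of the RAW partial
  Asai Euler product (`partialAsaiL`, a `tprod` with junk value `1`): ONE Asai datum whose raw product
  is non-multipliable at points accumulating at `1⁺` kills `HasAsaiPole` for both signs.  For rank
  `≥ 3` multipliability on `1 < Re s ≤ 3/2` is Ramanujan-strength (accepted
  `AsaiSignContinuation.lean`), so an obligation `HasAsaiSign … 1` on a representation not known to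
  be tempered is, as typed, beyond print and dischargeable only modulo the named fact
  `Mok2014_partialAsaiL_pole_dichotomy`.
* `signPin_cosets_disjoint`, `asaiSign_unique_of_signPin`, `exists_isAsaiDatum_of_signPin` — with
  the statement of `stub_signPin` as a (verbatim) hypothesis: the sign pin PROVES the uniqueness half
  of Mok's dichotomy for pane-type representations (so it is provable at best modulo that fact).

Mathlib + accepted tree only. [folklore]
-/

noncomputable section

-- single-conjunct summit `Summits/Langlands/Langlands` (D-0017): the doubled namespace is the tree's layout
set_option linter.dupNamespace false

open scoped Classical Topology
open Filter NumberField IsDedekindDomain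
open Literature.NumberTheory.Automorphic

namespace Summit.Langlands.Langlands.Theorems.HostInducedRep.Negative

variable {F E : Type} [Field F] [NumberField F] [Field E] [NumberField E] [Algebra F E]
  {N : ℕ} {hcpt : isCompact_glFiniteIntegralLevel N E}

/-- **Vacuity hazard of the typed pole predicate.**  `HasAsaiPole` quantifies over Asai data; a
representation datum with NO Asai datum has a pole at `s = 1` for BOTH signs. [folklore] -/
theorem hasAsaiPole_of_forall_not_isAsaiDatum (π : AutomorphicRepData (AutomorphyDatum.gl N E hcpt))
    (c : E ≃ₐ[F] E) (h : ∀ S A, ¬ π.IsAsaiDatum c S A) (η : ℤˣ) : π.HasAsaiPole c η :=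
  fun S A hSA ↦ (h S A hSA).elim

/-- … hence BOTH Asai signs hold for a datum without Asai data. [folklore] -/
theorem hasAsaiSign_of_forall_not_isAsaiDatum (π : AutomorphicRepData (AutomorphyDatum.gl N E hcpt))
    (c : E ≃ₐ[F] E) (h : ∀ S A, ¬ π.IsAsaiDatum c S A) (κ : ℤˣ) : π.HasAsaiSign c κ :=
  hasAsaiPole_of_forall_not_isAsaiDatum π c h _

/-- **A `c`-fixed place above a place unramified in the quadratic `E` is inert: `f(w|v) = 2`.**
The fibre of `v = w ∩ 𝓞 F` is the `{1, c}`-orbit of `w` (`HeightOneSpectrum.eq_or_eq_smul_of_under_eq`),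
i.e. `{w}`; the fundamental identity at an unramified `v` (`finsum_inertiaDeg_eq_finrank`) reads
`f(w|v) = [E : F] = 2`. [folklore] -/
theorem inertiaDeg_eq_two_of_smul_eq_of_isUnramifiedIn (h2 : Module.finrank F E = 2)
    {c : E ≃ₐ[F] E} (hc : c ≠ 1) {w : HeightOneSpectrum (𝓞 E)} (hcw : c • w = w)
    (hv : Algebra.IsUnramifiedIn (𝓞 E) (w.under (𝓞 F)).asIdeal) :
    w.asIdeal.inertiaDeg (𝓞 F) = 2 := by
  have h := finsum_inertiaDeg_eq_finrank (E := E) (w.under (𝓞 F)) hv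
  have hset : {w' : HeightOneSpectrum (𝓞 E) | w'.asIdeal.under (𝓞 F) = (w.under (𝓞 F)).asIdeal} =
      {w} := by
    ext w'
    simp only [Set.mem_setOf_eq, Set.mem_singleton_iff]
    constructor
    · intro hw'
      have hu : w'.under (𝓞 F) = w.under (𝓞 F) :=
        HeightOneSpectrum.ext (by rw [HeightOneSpectrum.under_asIdeal]; exact hw')
      rcases HeightOneSpectrum.eq_or_eq_smul_of_under_eq h2 hc hu with h' | h'
      · exact h'
      · rw [h', hcw]
    · rintro rfl
      rw [HeightOneSpectrum.under_asIdeal]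
  rw [hset, finsum_mem_singleton, h2] at h
  exact h

/-- **Asai data exist** for every automorphic representation datum of `GL_N(𝔸_E)` over a quadratic
`E/F` with non-trivial `c`: `S` = the places of `F` ramified in `E` (finitely many,
`finite_setOf_not_isUnramifiedIn`) together with the places below the finitely many places where
`π` has no Satake parameter (Flath, `hasSatakeParamAt_cofinite_holds`), `A w` = the Satake
parameter where there is one; `c`-fixed places above `v ∉ S` are inert
(`inertiaDeg_eq_two_of_smul_eq_of_isUnramifiedIn`). [folklore] -/
theorem exists_isAsaiDatum (h2 : Module.finrank F E = 2) {c : E ≃ₐ[F] E} (hc : c ≠ 1)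
    (π : AutomorphicRepData (AutomorphyDatum.gl N E hcpt)) :
    ∃ (S : Set (HeightOneSpectrum (𝓞 F))) (A : SatakeFamily E), π.IsAsaiDatum c S A := by
  set B : Set (HeightOneSpectrum (𝓞 E)) := {w | ¬ π.IsUnramifiedAt w} with hB
  have hBfin : B.Finite := by
    have h := AutomorphicRepData.hasSatakeParamAt_cofinite_holds π
    rwa [AutomorphicRepData.hasSatakeParamAt_cofinite, Filter.eventually_cofinite] at h
  set R : Set (HeightOneSpectrum (𝓞 F)) := {v | ¬ Algebra.IsUnramifiedIn (𝓞 E) v.asIdeal} with hR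
  have hRfin : R.Finite :=
    Literature.NumberTheory.GaloisRepresentations.finite_setOf_not_isUnramifiedIn F E
  refine ⟨R ∪ (fun w ↦ w.under (𝓞 F)) '' B,
    fun w ↦ if h : π.IsUnramifiedAt w then h.choose else 0, hRfin.union (hBfin.image _), ?_, ?_⟩
  · intro w hw
    have hunr : π.IsUnramifiedAt w := by
      by_contra hw'
      exact hw (Or.inr ⟨w, hw', rfl⟩)
    simp only [dif_pos hunr]
    exact hunr.choose_spec
  · intro w hw hcw
    have hunrIn : Algebra.IsUnramifiedIn (𝓞 E) (w.under (𝓞 F)).asIdeal := by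
      by_contra hv
      exact hw (Or.inl hv)
    exact inertiaDeg_eq_two_of_smul_eq_of_isUnramifiedIn h2 hc hcw hunrIn

/-- **One bad datum kills the typed pole for both signs.**  If for some Asai datum `(S, A)` the raw
partial Asai Euler product is not multipliable at points `s` accumulating at `1` inside
`{1 < Re s}`, then `partialAsaiL S c A η s = 1` there (junk value of `tprod`), `(s-1)·1 → 0`, and
`HasAsaiPole c η` fails — for every `η`.  For rank `≥ 3` multipliability on `1 < Re s ≤ 3/2` is
Ramanujan-strength (accepted `AsaiSignContinuation.lean`). [folklore] -/
theorem not_hasAsaiPole_of_frequently_not_multipliable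
    (π : AutomorphicRepData (AutomorphyDatum.gl N E hcpt)) (c : E ≃ₐ[F] E)
    {S : Set (HeightOneSpectrum (𝓞 F))} {A : SatakeFamily E} (hSA : π.IsAsaiDatum c S A) (η : ℤˣ)
    (h : ∃ᶠ s in 𝓝[{s : ℂ | 1 < s.re}] 1,
      ¬ Multipliable fun v : {v : HeightOneSpectrum (𝓞 F) // v ∉ S} =>
        ((asaiLocalPolynomial c A η (placeAbove E v.1)).eval ((v.1.residueCard : ℂ) ^ (-s)))⁻¹) :
    ¬ π.HasAsaiPole c η := by
  intro hpole
  obtain ⟨r, hr, hlim⟩ := hpole hSA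
  set L : Filter ℂ := 𝓝[{s : ℂ | 1 < s.re}] 1 with hL
  set T : Set ℂ := {s | ¬ Multipliable fun v : {v : HeightOneSpectrum (𝓞 F) // v ∉ S} =>
    ((asaiLocalPolynomial c A η (placeAbove E v.1)).eval ((v.1.residueCard : ℂ) ^ (-s)))⁻¹} with hT
  haveI hne : (L ⊓ 𝓟 T).NeBot := Filter.frequently_iff_neBot.mp h
  have h1 : Tendsto (fun s ↦ (s - 1) * partialAsaiL S c A η s) (L ⊓ 𝓟 T) (𝓝 r) :=
    hlim.mono_left inf_le_left
  have h0 : Tendsto (fun s : ℂ ↦ s - 1) (L ⊓ 𝓟 T) (𝓝 0) :=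
    tendsto_sub_one_nhdsWithin_one_lt_re.mono_left inf_le_left
  have heq : (fun s : ℂ ↦ s - 1) =ᶠ[L ⊓ 𝓟 T] fun s ↦ (s - 1) * partialAsaiL S c A η s := by
    refine Filter.eventually_inf_principal.mpr (Filter.Eventually.of_forall fun s hs ↦ ?_)
    show s - 1 = (s - 1) * partialAsaiL S c A η s
    unfold partialAsaiL
    rw [tprod_eq_one_of_not_multipliable hs, mul_one]
  exact hr (tendsto_nhds_unique h1 (h0.congr' heq))

/-- The two cosets pinned by `κ = 1` and `κ = -1` in `stub_signPin` (`(N-1)/2 + (1-κ)/4 + ℤ`) are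
disjoint (`(1-κ)/4 ∈ {0, ½}`; they differ by `½ ∉ ℤ`). [folklore] -/
theorem signPin_cosets_disjoint (N : ℕ) (a : ℂ)
    (h₁ : ∃ m : ℤ, a = (m : ℂ) + ((N : ℂ) - 1) / 2 + (1 - (((1 : ℤˣ) : ℤ) : ℂ)) / 4)
    (h₂ : ∃ m : ℤ, a = (m : ℂ) + ((N : ℂ) - 1) / 2 + (1 - (((-1 : ℤˣ) : ℤ) : ℂ)) / 4) : False := by
  obtain ⟨m₁, hm₁⟩ := h₁
  obtain ⟨m₂, hm₂⟩ := h₂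
  have h : ((2 * (m₁ - m₂) : ℤ) : ℂ) = ((1 : ℤ) : ℂ) := by
    push_cast
    rw [hm₁] at hm₂
    push_cast at hm₂
    linear_combination 2 * hm₂
  exact absurd (Int.cast_injective h) (by omega)

/-- **The sign pin proves the uniqueness half of Mok's dichotomy for pane-type `P`.**  The
hypothesis `hpin` is the statement of the lever `stub_signPin` of `Lines/one-transparent-pane.lean`,
VERBATIM (the Asai sign `κ` pins the coset of the archimedean exponents at a `c`-fixed complex place
to `(N-1)/2 + (1-κ)/4 + ℤ`).  Under it, a cuspidal conjugate self-dual `P` (`N ≥ 1`) over a quadratic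
`E/F` with a `c`-fixed complex place `σ` showing a multiplicity-free, NONEMPTY set of exponents in
one real coset has AT MOST ONE typed Asai sign — what the tree otherwise takes from the named fact
`Mok2014_partialAsaiL_pole_dichotomy` (`hasAsaiPole_unique`).  So `stub_signPin` is provable at best
modulo that fact. [folklore] -/
theorem asaiSign_unique_of_signPin
    (hpin : ∀ (F E : Type) [Field F] [NumberField F] [Field E] [NumberField E] [Algebra F E]
        (c : E ≃ₐ[F] E), Module.finrank F E = 2 → c ≠ 1 →
      ∀ (N : ℕ) (hcpt : isCompact_glFiniteIntegralLevel N E) (P : CuspidalAutomorphicRepData N E hcpt)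
        (κ : ℤˣ) (χ : (E →+* ℂ) → Multiset ℂ) (σ : E →+* ℂ) (r : ℝ),
        0 < N → P.1.IsConjSelfDualAE c → P.1.HasAsaiSign c κ → P.1.HasArchParameter χ →
        NumberField.ComplexEmbedding.IsConj σ c → (χ σ).Nodup →
        (∀ a ∈ χ σ, ∃ m : ℤ, a = (m : ℂ) + (r : ℂ)) →
        ∀ a ∈ χ σ, ∃ m : ℤ, a = (m : ℂ) + ((N : ℂ) - 1) / 2 + (1 - ((κ : ℤ) : ℂ)) / 4)
    {c : E ≃ₐ[F] E} (h2 : Module.finrank F E = 2)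
    (hc : c ≠ 1) (P : CuspidalAutomorphicRepData N E hcpt) (hN : 0 < N)
    (hcsd : P.1.IsConjSelfDualAE c) {χ : (E →+* ℂ) → Multiset ℂ} (hχ : P.1.HasArchParameter χ)
    {σ : E →+* ℂ} (hσ : NumberField.ComplexEmbedding.IsConj σ c) (hnd : (χ σ).Nodup) {r : ℝ}
    (hcoset : ∀ a ∈ χ σ, ∃ m : ℤ, a = (m : ℂ) + (r : ℂ)) {a : ℂ} (ha : a ∈ χ σ)
    {κ κ' : ℤˣ} (hκ : P.1.HasAsaiSign c κ) (hκ' : P.1.HasAsaiSign c κ') : κ = κ' := by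
  have h := fun (θ : ℤˣ) (hθ : P.1.HasAsaiSign c θ) ↦
    hpin F E c h2 hc N hcpt P θ χ σ r hN hcsd hθ hχ hσ hnd hcoset a ha
  rcases Int.units_eq_one_or κ with rfl | rfl <;> rcases Int.units_eq_one_or κ' with rfl | rfl
  · rfl
  · exact (signPin_cosets_disjoint N a (h 1 hκ) (h (-1) hκ')).elim
  · exact (signPin_cosets_disjoint N a (h 1 hκ') (h (-1) hκ)).elim
  · rfl

/-- Corollary (the pin also consumes Flath): under the statement of `stub_signPin`, a pane-type `P`
as above necessarily ADMITS an Asai datum — otherwise both signs hold vacuously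
(`hasAsaiSign_of_forall_not_isAsaiDatum`) and `1 = -1`.  (Outright true by `exists_isAsaiDatum`;
recorded to show which tree facts any proof of the stub touches.) [folklore] -/
theorem exists_isAsaiDatum_of_signPin
    (hpin : ∀ (F E : Type) [Field F] [NumberField F] [Field E] [NumberField E] [Algebra F E]
        (c : E ≃ₐ[F] E), Module.finrank F E = 2 → c ≠ 1 →
      ∀ (N : ℕ) (hcpt : isCompact_glFiniteIntegralLevel N E) (P : CuspidalAutomorphicRepData N E hcpt)
        (κ : ℤˣ) (χ : (E →+* ℂ) → Multiset ℂ) (σ : E →+* ℂ) (r : ℝ),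
        0 < N → P.1.IsConjSelfDualAE c → P.1.HasAsaiSign c κ → P.1.HasArchParameter χ →
        NumberField.ComplexEmbedding.IsConj σ c → (χ σ).Nodup →
        (∀ a ∈ χ σ, ∃ m : ℤ, a = (m : ℂ) + (r : ℂ)) →
        ∀ a ∈ χ σ, ∃ m : ℤ, a = (m : ℂ) + ((N : ℂ) - 1) / 2 + (1 - ((κ : ℤ) : ℂ)) / 4)
    {c : E ≃ₐ[F] E} (h2 : Module.finrank F E = 2)
    (hc : c ≠ 1) (P : CuspidalAutomorphicRepData N E hcpt) (hN : 0 < N)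
    (hcsd : P.1.IsConjSelfDualAE c) {χ : (E →+* ℂ) → Multiset ℂ} (hχ : P.1.HasArchParameter χ)
    {σ : E →+* ℂ} (hσ : NumberField.ComplexEmbedding.IsConj σ c) (hnd : (χ σ).Nodup) {r : ℝ}
    (hcoset : ∀ a ∈ χ σ, ∃ m : ℤ, a = (m : ℂ) + (r : ℂ)) {a : ℂ} (ha : a ∈ χ σ) :
    ∃ (S : Set (HeightOneSpectrum (𝓞 F))) (A : SatakeFamily E), P.1.IsAsaiDatum c S A := by
  by_contra hno
  push Not at hno
  have hboth := hasAsaiSign_of_forall_not_isAsaiDatum P.1 c hno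
  exact absurd (asaiSign_unique_of_signPin hpin h2 hc P hN hcsd hχ hσ hnd hcoset ha (hboth 1)
    (hboth (-1))) (by decide)

end Summit.Langlands.Langlands.Theorems.HostInducedRep.Negative

end
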